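import Summits.HodgeConjecture.HodgeConjecture.Cruxes.BlochSeedDiscOne.MinMassWindowH14
import Summits.HodgeConjecture.HodgeConjecture.Cruxes.BlochSeedDiscOne.ShellThreePairLaw
import Summits.HodgeConjecture.HodgeConjecture.Cruxes.BlochSeedDiscOne.DeepLayerLaws

/-!
# One-signed (A1)-clean shells and P-charged designs (strengthen g24)

line stmt-HodgeConjecture-18881 Cruxes/BlochSeedDiscOne/Lines/birth.lean 814a6a70c14e831a stub_rung_pad4_seedAt

HONESTY LABEL.  Nothing in this file is a rung toward HC ∕ HC_CM ∕ HC_AV ∕ №4 ∕ 26512 ∕ 18881 ∕ H2, and nothing here is claimed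
toward them.  It is kernel EVIDENCE for the S⁺ programme of the strengthen lens on the door of record
`RuleDPlate.SPlus 14 sigmaH 0` (OPEN off the axis, `AxisSPlus.sPlus_iff_offAxis`): it SETTLES the structural question Q-P left open by
DOOR-PRICE-extremal-g24 §5 ∕ strengthen g23 HANDOFF NEXT (3) —

  «is there an (A1)-clean design with μ ≠ 0 all of whose fully charged cells are P-cells?»

— in the strongest possible sense (§1–§4), and it proves what RULE D then forces on such designs (§5–§6).

## §1–§4  THE DIAGONAL SHELL `Q` — a ONE-SIGNED (A1)-clean design (kernel certificate)

`Q` has NO N-cells at all and 128 P-cells on the height-14 alphabet: for every non-empty slot set `S ⊆ {0,1,2,3}` the cells carrying a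
rotation `d_p = (12; (1+i)·i^p)` of the diagonal letter `d = (12;1,1)` on the slots of `S` and the hub `H = (14;0,0)` off `S`, with
phases `p ∈ {0,2}^S` and mass `64/2^{|S|}` when `|S| ≤ 3`, and phases in `S₀ = {p ∈ (ℤ/4)⁴ : Σ p ≡ 0 (4)}` (64 cells, mass 1) when
`S = {0,1,2,3}`.  KERNEL FACTS (`cert_Q`): `OnAlphabet 14`, (A1)-clean, `μ = 256`, `E = −1024`, rank `−960`, 960 copies, `Q.N = []`,
e-free rows `T(w) = 64·14^{deg w} − 1024·13^{deg w}`; Branch B (`2E + |Re μ| ≤ 0`); `¬ RuleDP Q` (no N-cell supplies the charged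
cell `d⁴`).  Transported to every height `h ≥ 2` (§4, `cert_QAt`).

CONSEQUENCES (§3): `onesigned_exists` ∕ `nonly_exists` (swap the sides: `P = []`, `μ = −256`); the answer to Q-P is
**NO LAW**: `not_hubfreeN_forced` — (A1) ∧ μ ≠ 0 does not force a fully charged (= hub-free) N-cell, indeed `not_suppN_forced` — it does not
even force an N-cell.  So every law of the shape «(A1) ∧ μ ≠ 0 ⇒ the N side contains …» is FALSE off the axis; any such conclusion for
door designs must use RULE D ∕ Hall (§5–§6 start that).  On the axis the opposite holds (`E = 0` there, while a one-signed design has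
`E = −Σ_P m·dep < 0`; cf. `E_eq_neg_of_pcharged`), so one-signedness is an OFF-AXIS phenomenon.

WHY `Q` IS (A1)-CLEAN (pen; the kernel table `tableQ` is the proof).  (i) PHASES: a word with an e-slot at `f` kills every cell with
`H` at `f`; on an `S`-family with `|S| ≤ 3` the phase sum over `{0,2}^S` factors as `∏_{e-slots} (1 + (−1)) = 0`; on the top family the
phase sum is `Σ_{p ∈ S₀} i^{⟨k,p⟩}` for the sign vector `k ∈ {0,±1}⁴` of the word, which vanishes unless `k ∈ S₀^⊥ = ℤ·(1,1,1,1)`, i.e.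
unless the word is `eeee` ∕ `ēēēē` (then it is `64·β̄_d^4 = 64·(1−i)⁴ = −256`).  (ii) E-FREE ROWS — THE PHANTOM LETTER: in the basis
`(1, h, pt)` a letter `ℓ` reads `v_ℓ = (1, a, a² − |β|²)`; the e-free part of (A1) says `T|_{e-free} ∈ span{(1, z, z²)^{⊗4}}` (the
moment conic).  For the diagonal letter `v_d + v_H = (2, 26, 338) = 2·(1, 13, 13²)` (`phantom`: `d` and `H` average to the PHANTOM
AXIS POINT of level 13), and every `S`-family of `Q` has total mass 64, so `T_Q|_{e-free} = −64·[(v_d + v_H)^{⊗4} − v_H^{⊗4}] =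
−1024·(1,13,169)^{⊗4} + 64·(1,14,196)^{⊗4}` — degree-only.  More generally (pen, not typed): for ANY off-axis letter `ℓ = (a;x,y)` the
weighted shell `(|β|²·H + 2|xy|·ℓ)^{⊗4}` (binomial masses `∝ (2|xy|)^{|S|}·(|β|²)^{4−|S|}`, same phase families) is a one-signed
(A1)-clean design with `μ ≠ 0`: the barycentre condition `Var(a) = mean |β|²` puts `w_H v_H + w_ℓ v_ℓ` on the conic iff
`w_H : w_ℓ = |β|² : 2|xy|`, which has a positive solution iff `xy ≠ 0`.  Axis letters admit none — consistent with `E = 0` on the axis.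

SYMMETRIC-ROOM REMARK (pen, memo-34 §2): for any rotation- and slot-symmetric pair of cell families `(𝒩, 𝒫)` the LINEAR feasibility of
«(A1), Re μ = 1, supp N ⊆ 𝒩, supp P ⊆ 𝒫, masses ∈ ℚ_{≥0}» is decided by the e-free rows and the sign pattern of `Re ∏ β̄` alone: a Farkas
certificate can be averaged over `S₀ ⋊ S₄`, and `S₀`-averaging kills every (A1) phase row (their characters are non-trivial on `S₀`).
So the phase rows (clause 1 of (A1), the phase-torus calculus) never obstruct a symmetric ROOM; they constrain only the asymmetric
placement of the two signs inside it.  `Q` is the instance `𝒩 = ∅`, `𝒫 = all cells`.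

## §5  P-CHARGED DESIGNS: `E`, hub-free P-cells, Branch B (structural, every height)

`PCharged D` := every supported N-cell has a letter of co-level 0 (no hub-free N-cell).  For such `D` on the height-`h` alphabet:
`linZ D.N dep = 0`, so `E = −Σ_P m·dep ≤ 0` (`E_eq_neg_of_pcharged`); `μ ≠ 0 ⇒` a hub-free P-cell (`hubfreeP_of_mu_ne`), hence with (A1)
`E ≤ −8` (`E_le_of_pcharged`, `8 ∣ E`); and `|Re μ|, |Im μ| ≤ Σ_P m·dep = −E` (`abs_mu_le_of_pcharged`, the 1-norm `|Re|+|Im|` is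
submultiplicative on `ℤ[i]` and equals the co-level on `β̄`), so P-charged (A1) designs with `μ ≠ 0` are in BRANCH B:
`2E + |Re μ| ≤ 0 ∧ 2E + |Im μ| ≤ 0` (`branchB_of_pcharged`) — P pair-carriers at all six slot pairs (`pcharged_pCarrier`).

## §6  THE COMPASS LEMMA (RULE D, P-side) and the corner package

`compass`: if `RuleDP D` holds and `D` is P-charged, every HUB-FREE P-cell `x` has an AXIS letter on every block `{g,j}` — the
supplier `y` above `x` at `{g,j}` is hub-bearing, agrees with the charged `x` off the block, so its hub sits at `g` or `j`, one null step
above `x_g` or `x_j`, and only axis letters null-step to the hub (`DeepLayerLaws.nullStep_hub_iff`).  Hence a hub-free P-cell of a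
P-charged RULE-D design has AT MOST ONE off-axis letter (`atMostOneOffAxis`); contrapositively a hub-free P-cell with two off-axis letters
forces a hub-free N-cell (`hubfreeN_of_twoOffAxis`).  With `Disj`: six HH-cornered 2-fat P-cells (`pcharged_corner`, via
`hhCorner_of_pCarrier`) — necessarily hub-BEARING, so the P side of a P-charged door design splits into COMPASS hub-free cells (≤ 1 fat
letter; they alone carry `μ`, `E = −Σ_P m·dep` and the negative ray classes) and hub-bearing FAT cells (they carry the Branch-B pair counts
`k^P(g,g′) = −E/4 + k^N(g,g′) ≥ 2`, `ShellThreePairLaw`) — and the twelve edge N-cells of `ShellThreePairLaw.hhCorner_edges_of_branchB`.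
(v1.1: this sentence corrected — v1.0 wrongly attributed `E` to the hub-bearing cells, on which `dep` vanishes.)

SEQUEL (same seat, `PChargedTwin.lean`): S⁺_PC WITHOUT the Σ-budget is FALSE — a disjoint, P-charged, (A1)-clean RULE-D design with
`μ ≠ 0` (indeed with `HallUp ∧ HallPlusUp 8`, off-axis, ring 2) exists; so the conclusion of `hubfreeN_of_twoOffAxis` cannot be upgraded to
«RULE D ∧ Disj ⇒ hub-free N-cell», and S⁺_PC lives on the budget (N-mass ≤ 58).

WHAT THIS DOES NOT DO.  It does not inhabit or close the door: `Q` violates RULE D maximally (`not_ruleDP_Q`), and §5–§6 are the first two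
typed steps of the sub-piece S⁺_PC «no P-charged door design» of the branch split S⁺ = S⁺_A ∧ S⁺_B (S⁺-ledger #247), not its proof.
`decide +kernel` ∕ `decide` only; no `native_decide`, no `sorry`, no `axiom`, no `instance`, no notation, no Literature fact.
-/

set_option linter.dupNamespace false

namespace Summit.HodgeConjecture.HodgeConjecture.Cruxes.BlochSeedDiscOne.OneSignedShell

open Summit.HodgeConjecture.HodgeConjecture.Cruxes.BlochSeedDiscOne.DepthBoundA4
open Summit.HodgeConjecture.HodgeConjecture.Cruxes.BlochSeedDiscOne.HeightTower
open Summit.HodgeConjecture.HodgeConjecture.Cruxes.BlochSeedDiscOne.LeggedFloor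
open Summit.HodgeConjecture.HodgeConjecture.Cruxes.BlochSeedDiscOne.MinMassWindowH14
open Summit.HodgeConjecture.HodgeConjecture.Cruxes.BlochSeedDiscOne.RingTwoMassLaw.CI (A1e a1e_of_a1)
open Summit.HodgeConjecture.HodgeConjecture.Cruxes.BlochSeedDiscOne.RingTwoMassLaw.ClassLaw
open Summit.HodgeConjecture.HodgeConjecture.Cruxes.BlochSeedDiscOne.ShellThreePairLaw
open Summit.HodgeConjecture.HodgeConjecture.Cruxes.BlochSeedDiscOne.DeepLayerLaws
  (nullStep_hub_iff colevel_pos_iff colevel_eq_zero_iff eq_hub_of_colevel_eq_zero colevel_hub colevel_nonneg colevel_eq_of_onAlphabet)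

/-! ## §1 The diagonal shell `Q` (P side only) -/

/-- the 128 P-entries of the diagonal shell: rotations of `d = (12;1,1)` on a slot set `S ≠ ∅`, hubs elsewhere; masses `64/2^{|S|}`
(`|S| ≤ 3`, phases in `{0,2}^S`) and `1` (`S` full, phases in `S₀`). -/
def QP : List (Cell × ℕ) := [
  (cellOf ⟨12, 1, 1⟩ ⟨14, 0, 0⟩ ⟨14, 0, 0⟩ ⟨14, 0, 0⟩, 32),
  (cellOf ⟨12, -1, -1⟩ ⟨14, 0, 0⟩ ⟨14, 0, 0⟩ ⟨14, 0, 0⟩, 32),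
  (cellOf ⟨14, 0, 0⟩ ⟨12, 1, 1⟩ ⟨14, 0, 0⟩ ⟨14, 0, 0⟩, 32),
  (cellOf ⟨14, 0, 0⟩ ⟨12, -1, -1⟩ ⟨14, 0, 0⟩ ⟨14, 0, 0⟩, 32),
  (cellOf ⟨14, 0, 0⟩ ⟨14, 0, 0⟩ ⟨12, 1, 1⟩ ⟨14, 0, 0⟩, 32),
  (cellOf ⟨14, 0, 0⟩ ⟨14, 0, 0⟩ ⟨12, -1, -1⟩ ⟨14, 0, 0⟩, 32),
  (cellOf ⟨14, 0, 0⟩ ⟨14, 0, 0⟩ ⟨14, 0, 0⟩ ⟨12, 1, 1⟩, 32),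
  (cellOf ⟨14, 0, 0⟩ ⟨14, 0, 0⟩ ⟨14, 0, 0⟩ ⟨12, -1, -1⟩, 32),
  (cellOf ⟨12, 1, 1⟩ ⟨12, 1, 1⟩ ⟨14, 0, 0⟩ ⟨14, 0, 0⟩, 16),
  (cellOf ⟨12, 1, 1⟩ ⟨12, -1, -1⟩ ⟨14, 0, 0⟩ ⟨14, 0, 0⟩, 16),
  (cellOf ⟨12, -1, -1⟩ ⟨12, 1, 1⟩ ⟨14, 0, 0⟩ ⟨14, 0, 0⟩, 16),
  (cellOf ⟨12, -1, -1⟩ ⟨12, -1, -1⟩ ⟨14, 0, 0⟩ ⟨14, 0, 0⟩, 16),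
  (cellOf ⟨12, 1, 1⟩ ⟨14, 0, 0⟩ ⟨12, 1, 1⟩ ⟨14, 0, 0⟩, 16),
  (cellOf ⟨12, 1, 1⟩ ⟨14, 0, 0⟩ ⟨12, -1, -1⟩ ⟨14, 0, 0⟩, 16),
  (cellOf ⟨12, -1, -1⟩ ⟨14, 0, 0⟩ ⟨12, 1, 1⟩ ⟨14, 0, 0⟩, 16),
  (cellOf ⟨12, -1, -1⟩ ⟨14, 0, 0⟩ ⟨12, -1, -1⟩ ⟨14, 0, 0⟩, 16),
  (cellOf ⟨12, 1, 1⟩ ⟨14, 0, 0⟩ ⟨14, 0, 0⟩ ⟨12, 1, 1⟩, 16),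
  (cellOf ⟨12, 1, 1⟩ ⟨14, 0, 0⟩ ⟨14, 0, 0⟩ ⟨12, -1, -1⟩, 16),
  (cellOf ⟨12, -1, -1⟩ ⟨14, 0, 0⟩ ⟨14, 0, 0⟩ ⟨12, 1, 1⟩, 16),
  (cellOf ⟨12, -1, -1⟩ ⟨14, 0, 0⟩ ⟨14, 0, 0⟩ ⟨12, -1, -1⟩, 16),
  (cellOf ⟨14, 0, 0⟩ ⟨12, 1, 1⟩ ⟨12, 1, 1⟩ ⟨14, 0, 0⟩, 16),
  (cellOf ⟨14, 0, 0⟩ ⟨12, 1, 1⟩ ⟨12, -1, -1⟩ ⟨14, 0, 0⟩, 16),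
  (cellOf ⟨14, 0, 0⟩ ⟨12, -1, -1⟩ ⟨12, 1, 1⟩ ⟨14, 0, 0⟩, 16),
  (cellOf ⟨14, 0, 0⟩ ⟨12, -1, -1⟩ ⟨12, -1, -1⟩ ⟨14, 0, 0⟩, 16),
  (cellOf ⟨14, 0, 0⟩ ⟨12, 1, 1⟩ ⟨14, 0, 0⟩ ⟨12, 1, 1⟩, 16),
  (cellOf ⟨14, 0, 0⟩ ⟨12, 1, 1⟩ ⟨14, 0, 0⟩ ⟨12, -1, -1⟩, 16),
  (cellOf ⟨14, 0, 0⟩ ⟨12, -1, -1⟩ ⟨14, 0, 0⟩ ⟨12, 1, 1⟩, 16),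
  (cellOf ⟨14, 0, 0⟩ ⟨12, -1, -1⟩ ⟨14, 0, 0⟩ ⟨12, -1, -1⟩, 16),
  (cellOf ⟨14, 0, 0⟩ ⟨14, 0, 0⟩ ⟨12, 1, 1⟩ ⟨12, 1, 1⟩, 16),
  (cellOf ⟨14, 0, 0⟩ ⟨14, 0, 0⟩ ⟨12, 1, 1⟩ ⟨12, -1, -1⟩, 16),
  (cellOf ⟨14, 0, 0⟩ ⟨14, 0, 0⟩ ⟨12, -1, -1⟩ ⟨12, 1, 1⟩, 16),
  (cellOf ⟨14, 0, 0⟩ ⟨14, 0, 0⟩ ⟨12, -1, -1⟩ ⟨12, -1, -1⟩, 16),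
  (cellOf ⟨12, 1, 1⟩ ⟨12, 1, 1⟩ ⟨12, 1, 1⟩ ⟨14, 0, 0⟩, 8),
  (cellOf ⟨12, 1, 1⟩ ⟨12, 1, 1⟩ ⟨12, -1, -1⟩ ⟨14, 0, 0⟩, 8),
  (cellOf ⟨12, 1, 1⟩ ⟨12, -1, -1⟩ ⟨12, 1, 1⟩ ⟨14, 0, 0⟩, 8),
  (cellOf ⟨12, 1, 1⟩ ⟨12, -1, -1⟩ ⟨12, -1, -1⟩ ⟨14, 0, 0⟩, 8),
  (cellOf ⟨12, -1, -1⟩ ⟨12, 1, 1⟩ ⟨12, 1, 1⟩ ⟨14, 0, 0⟩, 8),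
  (cellOf ⟨12, -1, -1⟩ ⟨12, 1, 1⟩ ⟨12, -1, -1⟩ ⟨14, 0, 0⟩, 8),
  (cellOf ⟨12, -1, -1⟩ ⟨12, -1, -1⟩ ⟨12, 1, 1⟩ ⟨14, 0, 0⟩, 8),
  (cellOf ⟨12, -1, -1⟩ ⟨12, -1, -1⟩ ⟨12, -1, -1⟩ ⟨14, 0, 0⟩, 8),
  (cellOf ⟨12, 1, 1⟩ ⟨12, 1, 1⟩ ⟨14, 0, 0⟩ ⟨12, 1, 1⟩, 8),
  (cellOf ⟨12, 1, 1⟩ ⟨12, 1, 1⟩ ⟨14, 0, 0⟩ ⟨12, -1, -1⟩, 8),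
  (cellOf ⟨12, 1, 1⟩ ⟨12, -1, -1⟩ ⟨14, 0, 0⟩ ⟨12, 1, 1⟩, 8),
  (cellOf ⟨12, 1, 1⟩ ⟨12, -1, -1⟩ ⟨14, 0, 0⟩ ⟨12, -1, -1⟩, 8),
  (cellOf ⟨12, -1, -1⟩ ⟨12, 1, 1⟩ ⟨14, 0, 0⟩ ⟨12, 1, 1⟩, 8),
  (cellOf ⟨12, -1, -1⟩ ⟨12, 1, 1⟩ ⟨14, 0, 0⟩ ⟨12, -1, -1⟩, 8),
  (cellOf ⟨12, -1, -1⟩ ⟨12, -1, -1⟩ ⟨14, 0, 0⟩ ⟨12, 1, 1⟩, 8),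
  (cellOf ⟨12, -1, -1⟩ ⟨12, -1, -1⟩ ⟨14, 0, 0⟩ ⟨12, -1, -1⟩, 8),
  (cellOf ⟨12, 1, 1⟩ ⟨14, 0, 0⟩ ⟨12, 1, 1⟩ ⟨12, 1, 1⟩, 8),
  (cellOf ⟨12, 1, 1⟩ ⟨14, 0, 0⟩ ⟨12, 1, 1⟩ ⟨12, -1, -1⟩, 8),
  (cellOf ⟨12, 1, 1⟩ ⟨14, 0, 0⟩ ⟨12, -1, -1⟩ ⟨12, 1, 1⟩, 8),
  (cellOf ⟨12, 1, 1⟩ ⟨14, 0, 0⟩ ⟨12, -1, -1⟩ ⟨12, -1, -1⟩, 8),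
  (cellOf ⟨12, -1, -1⟩ ⟨14, 0, 0⟩ ⟨12, 1, 1⟩ ⟨12, 1, 1⟩, 8),
  (cellOf ⟨12, -1, -1⟩ ⟨14, 0, 0⟩ ⟨12, 1, 1⟩ ⟨12, -1, -1⟩, 8),
  (cellOf ⟨12, -1, -1⟩ ⟨14, 0, 0⟩ ⟨12, -1, -1⟩ ⟨12, 1, 1⟩, 8),
  (cellOf ⟨12, -1, -1⟩ ⟨14, 0, 0⟩ ⟨12, -1, -1⟩ ⟨12, -1, -1⟩, 8),
  (cellOf ⟨14, 0, 0⟩ ⟨12, 1, 1⟩ ⟨12, 1, 1⟩ ⟨12, 1, 1⟩, 8),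
  (cellOf ⟨14, 0, 0⟩ ⟨12, 1, 1⟩ ⟨12, 1, 1⟩ ⟨12, -1, -1⟩, 8),
  (cellOf ⟨14, 0, 0⟩ ⟨12, 1, 1⟩ ⟨12, -1, -1⟩ ⟨12, 1, 1⟩, 8),
  (cellOf ⟨14, 0, 0⟩ ⟨12, 1, 1⟩ ⟨12, -1, -1⟩ ⟨12, -1, -1⟩, 8),
  (cellOf ⟨14, 0, 0⟩ ⟨12, -1, -1⟩ ⟨12, 1, 1⟩ ⟨12, 1, 1⟩, 8),
  (cellOf ⟨14, 0, 0⟩ ⟨12, -1, -1⟩ ⟨12, 1, 1⟩ ⟨12, -1, -1⟩, 8),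
  (cellOf ⟨14, 0, 0⟩ ⟨12, -1, -1⟩ ⟨12, -1, -1⟩ ⟨12, 1, 1⟩, 8),
  (cellOf ⟨14, 0, 0⟩ ⟨12, -1, -1⟩ ⟨12, -1, -1⟩ ⟨12, -1, -1⟩, 8),
  (cellOf ⟨12, 1, 1⟩ ⟨12, 1, 1⟩ ⟨12, 1, 1⟩ ⟨12, 1, 1⟩, 1),
  (cellOf ⟨12, 1, 1⟩ ⟨12, 1, 1⟩ ⟨12, -1, 1⟩ ⟨12, 1, -1⟩, 1),
  (cellOf ⟨12, 1, 1⟩ ⟨12, 1, 1⟩ ⟨12, -1, -1⟩ ⟨12, -1, -1⟩, 1),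
  (cellOf ⟨12, 1, 1⟩ ⟨12, 1, 1⟩ ⟨12, 1, -1⟩ ⟨12, -1, 1⟩, 1),
  (cellOf ⟨12, 1, 1⟩ ⟨12, -1, 1⟩ ⟨12, 1, 1⟩ ⟨12, 1, -1⟩, 1),
  (cellOf ⟨12, 1, 1⟩ ⟨12, -1, 1⟩ ⟨12, -1, 1⟩ ⟨12, -1, -1⟩, 1),
  (cellOf ⟨12, 1, 1⟩ ⟨12, -1, 1⟩ ⟨12, -1, -1⟩ ⟨12, -1, 1⟩, 1),
  (cellOf ⟨12, 1, 1⟩ ⟨12, -1, 1⟩ ⟨12, 1, -1⟩ ⟨12, 1, 1⟩, 1),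
  (cellOf ⟨12, 1, 1⟩ ⟨12, -1, -1⟩ ⟨12, 1, 1⟩ ⟨12, -1, -1⟩, 1),
  (cellOf ⟨12, 1, 1⟩ ⟨12, -1, -1⟩ ⟨12, -1, 1⟩ ⟨12, -1, 1⟩, 1),
  (cellOf ⟨12, 1, 1⟩ ⟨12, -1, -1⟩ ⟨12, -1, -1⟩ ⟨12, 1, 1⟩, 1),
  (cellOf ⟨12, 1, 1⟩ ⟨12, -1, -1⟩ ⟨12, 1, -1⟩ ⟨12, 1, -1⟩, 1),
  (cellOf ⟨12, 1, 1⟩ ⟨12, 1, -1⟩ ⟨12, 1, 1⟩ ⟨12, -1, 1⟩, 1),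
  (cellOf ⟨12, 1, 1⟩ ⟨12, 1, -1⟩ ⟨12, -1, 1⟩ ⟨12, 1, 1⟩, 1),
  (cellOf ⟨12, 1, 1⟩ ⟨12, 1, -1⟩ ⟨12, -1, -1⟩ ⟨12, 1, -1⟩, 1),
  (cellOf ⟨12, 1, 1⟩ ⟨12, 1, -1⟩ ⟨12, 1, -1⟩ ⟨12, -1, -1⟩, 1),
  (cellOf ⟨12, -1, 1⟩ ⟨12, 1, 1⟩ ⟨12, 1, 1⟩ ⟨12, 1, -1⟩, 1),
  (cellOf ⟨12, -1, 1⟩ ⟨12, 1, 1⟩ ⟨12, -1, 1⟩ ⟨12, -1, -1⟩, 1),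
  (cellOf ⟨12, -1, 1⟩ ⟨12, 1, 1⟩ ⟨12, -1, -1⟩ ⟨12, -1, 1⟩, 1),
  (cellOf ⟨12, -1, 1⟩ ⟨12, 1, 1⟩ ⟨12, 1, -1⟩ ⟨12, 1, 1⟩, 1),
  (cellOf ⟨12, -1, 1⟩ ⟨12, -1, 1⟩ ⟨12, 1, 1⟩ ⟨12, -1, -1⟩, 1),
  (cellOf ⟨12, -1, 1⟩ ⟨12, -1, 1⟩ ⟨12, -1, 1⟩ ⟨12, -1, 1⟩, 1),
  (cellOf ⟨12, -1, 1⟩ ⟨12, -1, 1⟩ ⟨12, -1, -1⟩ ⟨12, 1, 1⟩, 1),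
  (cellOf ⟨12, -1, 1⟩ ⟨12, -1, 1⟩ ⟨12, 1, -1⟩ ⟨12, 1, -1⟩, 1),
  (cellOf ⟨12, -1, 1⟩ ⟨12, -1, -1⟩ ⟨12, 1, 1⟩ ⟨12, -1, 1⟩, 1),
  (cellOf ⟨12, -1, 1⟩ ⟨12, -1, -1⟩ ⟨12, -1, 1⟩ ⟨12, 1, 1⟩, 1),
  (cellOf ⟨12, -1, 1⟩ ⟨12, -1, -1⟩ ⟨12, -1, -1⟩ ⟨12, 1, -1⟩, 1),
  (cellOf ⟨12, -1, 1⟩ ⟨12, -1, -1⟩ ⟨12, 1, -1⟩ ⟨12, -1, -1⟩, 1),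
  (cellOf ⟨12, -1, 1⟩ ⟨12, 1, -1⟩ ⟨12, 1, 1⟩ ⟨12, 1, 1⟩, 1),
  (cellOf ⟨12, -1, 1⟩ ⟨12, 1, -1⟩ ⟨12, -1, 1⟩ ⟨12, 1, -1⟩, 1),
  (cellOf ⟨12, -1, 1⟩ ⟨12, 1, -1⟩ ⟨12, -1, -1⟩ ⟨12, -1, -1⟩, 1),
  (cellOf ⟨12, -1, 1⟩ ⟨12, 1, -1⟩ ⟨12, 1, -1⟩ ⟨12, -1, 1⟩, 1),
  (cellOf ⟨12, -1, -1⟩ ⟨12, 1, 1⟩ ⟨12, 1, 1⟩ ⟨12, -1, -1⟩, 1),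
  (cellOf ⟨12, -1, -1⟩ ⟨12, 1, 1⟩ ⟨12, -1, 1⟩ ⟨12, -1, 1⟩, 1),
  (cellOf ⟨12, -1, -1⟩ ⟨12, 1, 1⟩ ⟨12, -1, -1⟩ ⟨12, 1, 1⟩, 1),
  (cellOf ⟨12, -1, -1⟩ ⟨12, 1, 1⟩ ⟨12, 1, -1⟩ ⟨12, 1, -1⟩, 1),
  (cellOf ⟨12, -1, -1⟩ ⟨12, -1, 1⟩ ⟨12, 1, 1⟩ ⟨12, -1, 1⟩, 1),
  (cellOf ⟨12, -1, -1⟩ ⟨12, -1, 1⟩ ⟨12, -1, 1⟩ ⟨12, 1, 1⟩, 1),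
  (cellOf ⟨12, -1, -1⟩ ⟨12, -1, 1⟩ ⟨12, -1, -1⟩ ⟨12, 1, -1⟩, 1),
  (cellOf ⟨12, -1, -1⟩ ⟨12, -1, 1⟩ ⟨12, 1, -1⟩ ⟨12, -1, -1⟩, 1),
  (cellOf ⟨12, -1, -1⟩ ⟨12, -1, -1⟩ ⟨12, 1, 1⟩ ⟨12, 1, 1⟩, 1),
  (cellOf ⟨12, -1, -1⟩ ⟨12, -1, -1⟩ ⟨12, -1, 1⟩ ⟨12, 1, -1⟩, 1),
  (cellOf ⟨12, -1, -1⟩ ⟨12, -1, -1⟩ ⟨12, -1, -1⟩ ⟨12, -1, -1⟩, 1),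
  (cellOf ⟨12, -1, -1⟩ ⟨12, -1, -1⟩ ⟨12, 1, -1⟩ ⟨12, -1, 1⟩, 1),
  (cellOf ⟨12, -1, -1⟩ ⟨12, 1, -1⟩ ⟨12, 1, 1⟩ ⟨12, 1, -1⟩, 1),
  (cellOf ⟨12, -1, -1⟩ ⟨12, 1, -1⟩ ⟨12, -1, 1⟩ ⟨12, -1, -1⟩, 1),
  (cellOf ⟨12, -1, -1⟩ ⟨12, 1, -1⟩ ⟨12, -1, -1⟩ ⟨12, -1, 1⟩, 1),
  (cellOf ⟨12, -1, -1⟩ ⟨12, 1, -1⟩ ⟨12, 1, -1⟩ ⟨12, 1, 1⟩, 1),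
  (cellOf ⟨12, 1, -1⟩ ⟨12, 1, 1⟩ ⟨12, 1, 1⟩ ⟨12, -1, 1⟩, 1),
  (cellOf ⟨12, 1, -1⟩ ⟨12, 1, 1⟩ ⟨12, -1, 1⟩ ⟨12, 1, 1⟩, 1),
  (cellOf ⟨12, 1, -1⟩ ⟨12, 1, 1⟩ ⟨12, -1, -1⟩ ⟨12, 1, -1⟩, 1),
  (cellOf ⟨12, 1, -1⟩ ⟨12, 1, 1⟩ ⟨12, 1, -1⟩ ⟨12, -1, -1⟩, 1),
  (cellOf ⟨12, 1, -1⟩ ⟨12, -1, 1⟩ ⟨12, 1, 1⟩ ⟨12, 1, 1⟩, 1),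
  (cellOf ⟨12, 1, -1⟩ ⟨12, -1, 1⟩ ⟨12, -1, 1⟩ ⟨12, 1, -1⟩, 1),
  (cellOf ⟨12, 1, -1⟩ ⟨12, -1, 1⟩ ⟨12, -1, -1⟩ ⟨12, -1, -1⟩, 1),
  (cellOf ⟨12, 1, -1⟩ ⟨12, -1, 1⟩ ⟨12, 1, -1⟩ ⟨12, -1, 1⟩, 1),
  (cellOf ⟨12, 1, -1⟩ ⟨12, -1, -1⟩ ⟨12, 1, 1⟩ ⟨12, 1, -1⟩, 1),
  (cellOf ⟨12, 1, -1⟩ ⟨12, -1, -1⟩ ⟨12, -1, 1⟩ ⟨12, -1, -1⟩, 1),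
  (cellOf ⟨12, 1, -1⟩ ⟨12, -1, -1⟩ ⟨12, -1, -1⟩ ⟨12, -1, 1⟩, 1),
  (cellOf ⟨12, 1, -1⟩ ⟨12, -1, -1⟩ ⟨12, 1, -1⟩ ⟨12, 1, 1⟩, 1),
  (cellOf ⟨12, 1, -1⟩ ⟨12, 1, -1⟩ ⟨12, 1, 1⟩ ⟨12, -1, -1⟩, 1),
  (cellOf ⟨12, 1, -1⟩ ⟨12, 1, -1⟩ ⟨12, -1, 1⟩ ⟨12, -1, 1⟩, 1),
  (cellOf ⟨12, 1, -1⟩ ⟨12, 1, -1⟩ ⟨12, -1, -1⟩ ⟨12, 1, 1⟩, 1),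
  (cellOf ⟨12, 1, -1⟩ ⟨12, 1, -1⟩ ⟨12, 1, -1⟩ ⟨12, 1, -1⟩, 1)
]

/-- **THE DIAGONAL SHELL** `Q`: no N-cells, the 128 P-entries `QP`. -/
def Q : Design := ⟨[], QP⟩

/-- the same shell on the N side: no P-cells. -/
def Qbar : Design := ⟨QP, []⟩

/-- the hub and the four diagonal letters of co-level 2. -/
def hub14 : Letter := ⟨14, 0, 0⟩
def d0 : Letter := ⟨12, 1, 1⟩

/-- **PHANTOM LETTER**: in the basis `(1, h, pt)` the diagonal letter and the hub add up to twice the moment-conic point of level 13: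
`(1,12,142) + (1,14,196) = 2·(1,13,169)`. -/
theorem phantom :
    Sym.one.coef d0 + Sym.one.coef hub14 = 2 * 13 ^ 0 ∧ Sym.h.coef d0 + Sym.h.coef hub14 = 2 * 13 ^ 1 ∧
    Sym.pt.coef d0 + Sym.pt.coef hub14 = 2 * 13 ^ 2 := by
  decide

/-! ## §2 Kernel computations for `Q` -/

/-- the e-free rows of `Q`: `64·14^deg − 1024·13^deg`. -/
def efreeSpecQ (dg : ℕ) : ℤ := 64 * 14 ^ dg - 1024 * 13 ^ dg

/-- one row of the class table of `Q`. -/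
def rowQ (w : Word) : Bool :=
  bif efreeB w then decide (rawT [] QP w = (efreeSpecQ (degB w), 0)) else (blochB w || decide (rawT [] QP w = (0, 0)))

theorem tableQ : allB allWords rowQ = true := by decide +kernel

theorem mu_rawQ : rawT [] QP Word.eeee = (256, 0) := by decide +kernel

theorem EEEE_rawQ : rawT [] QP Word.EEEE = (256, 0) := by decide +kernel

theorem mu_rawQbar : rawT QP [] Word.eeee = (-256, 0) := by decide +kernel

theorem copies_Q : Q.copies = 960 := by decide +kernel

theorem rank_Q : Q.rank = -960 := by decide +kernel

theorem length_QP : QP.length = 128 := by decide +kernel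

theorem alphaQP : allB QP (fun cm => onAlphaB 14 cm.1) = true := by decide +kernel

/-- level test `12 ≤ a` on all four letters. -/
def lev12B (c : Cell) : Bool := decide (12 ≤ (c 0).a) && decide (12 ≤ (c 1).a) && decide (12 ≤ (c 2).a) && decide (12 ≤ (c 3).a)

theorem levQP : allB QP (fun cm => lev12B cm.1) = true := by decide +kernel

theorem linZ_QP_dep : linZ QP (dep 14) = 1024 := by decide +kernel

/-- the fully charged cell `d⁴` is a P-entry. -/
def d4 : Cell := cellOf ⟨12, 1, 1⟩ ⟨12, 1, 1⟩ ⟨12, 1, 1⟩ ⟨12, 1, 1⟩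

theorem d4_mem : (d4, 1) ∈ QP := by decide +kernel

/-! ## §3 The certificate for `Q` and the answers to Q-P -/

theorem suppN_Q : Q.suppN = [] := rfl

theorem suppP_Qbar : Qbar.suppP = [] := rfl

theorem onAlphabet_Q : Q.OnAlphabet 14 := by
  intro c hc f
  rcases List.mem_append.1 hc with hN | hP
  · rw [suppN_Q] at hN; exact absurd hN List.not_mem_nil
  · obtain ⟨m, hm⟩ := exists_of_mem_suppP hP
    exact onAlphabet_of_B ((allB_iff _ _).1 alphaQP (c, m) hm) f

theorem onAlphabet_Qbar : Qbar.OnAlphabet 14 := by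
  intro c hc f
  rcases List.mem_append.1 hc with hN | hP
  · obtain ⟨m, hm⟩ := exists_of_mem_suppN hN
    exact onAlphabet_of_B ((allB_iff _ _).1 alphaQP (c, m) hm) f
  · rw [suppP_Qbar] at hP; exact absurd hP List.not_mem_nil

theorem level_of_lev12B {c : Cell} (hc : lev12B c = true) : ∀ f : Fin 4, 12 ≤ (c f).a := by
  simp only [lev12B, Bool.and_eq_true, decide_eq_true_eq] at hc
  obtain ⟨⟨⟨h0, h1⟩, h2⟩, h3⟩ := hc
  intro f
  fin_cases f
  · exact h0
  · exact h1
  · exact h2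
  · exact h3

theorem level_Q : ∀ c ∈ Q.suppN ++ Q.suppP, ∀ f : Fin 4, 12 ≤ (c f).a := by
  intro c hc f
  rcases List.mem_append.1 hc with hN | hP
  · rw [suppN_Q] at hN; exact absurd hN List.not_mem_nil
  · obtain ⟨m, hm⟩ := exists_of_mem_suppP hP
    exact level_of_lev12B ((allB_iff _ _).1 levQP (c, m) hm) f

theorem T_closedQ (w : Word) : Q.T w = toG (rawT [] QP w) := T_raw Q w

/-- E-FREE ROWS of `Q`: `T(w) = 64·14^{deg} − 1024·13^{deg}` (degree-only: the phantom letter of level 13). -/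
theorem efree_rows_Q (w : Word) (hw : w.efree) : Q.T w = ⟨efreeSpecQ w.deg, 0⟩ := by
  have hr := (allB_iff _ _).1 tableQ w (mem_allWords w)
  unfold rowQ at hr
  rw [efreeB_of_efree hw] at hr
  simp only [cond_true, decide_eq_true_eq] at hr
  rw [T_closedQ, hr, deg_eq_degB]
  rfl

/-- MIXED ROWS: every e-mixed word other than the two Bloch words vanishes. -/
theorem mixed_rows_Q (w : Word) (hne : ¬ w.efree) (h1 : w ≠ Word.eeee) (h2 : w ≠ Word.EEEE) : Q.T w = 0 := by
  have hr := (allB_iff _ _).1 tableQ w (mem_allWords w)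
  unfold rowQ at hr
  cases hb : efreeB w with
  | true => exact (hne (efree_of_efreeB hb)).elim
  | false =>
    rw [hb] at hr
    simp only [cond_false, Bool.or_eq_true, decide_eq_true_eq] at hr
    rcases hr with hbl | hz
    · rcases bloch_of_blochB hbl with h | h
      · exact (h1 h).elim
      · exact (h2 h).elim
    · rw [T_closedQ, hz]; ext <;> simp [toG]

/-- **`Q` IS (A1)-CLEAN.** -/
theorem a1_Q : Q.A1 :=
  ⟨mixed_rows_Q, fun w w' hw hw' hd => by rw [efree_rows_Q w hw, efree_rows_Q w' hw', hd]⟩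

theorem mu_Q : Q.mu = ⟨256, 0⟩ := by
  show Q.T Word.eeee = _
  rw [T_closedQ, mu_rawQ]
  rfl

theorem mu_ne_Q : Q.mu ≠ 0 := by rw [mu_Q]; decide

/-- the mirror: `T(Qbar) = −T(Q)` word by word. -/
theorem T_Qbar (w : Word) : Qbar.T w = -Q.T w := by
  unfold Design.T Qbar Q
  simp

theorem a1_Qbar : Qbar.A1 :=
  ⟨fun w hne h1 h2 => by rw [T_Qbar, mixed_rows_Q w hne h1 h2, neg_zero],
   fun w w' hw hw' hd => by rw [T_Qbar, T_Qbar, efree_rows_Q w hw, efree_rows_Q w' hw', hd]⟩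

theorem mu_Qbar : Qbar.mu = -⟨256, 0⟩ := by
  show Qbar.T Word.eeee = _
  rw [T_Qbar]
  show -(Q.mu) = _
  rw [mu_Q]

theorem mu_ne_Qbar : Qbar.mu ≠ 0 := by rw [mu_Qbar]; decide

/-- `E(Q) = −1024` (`= −Σ_P m·dep`: the shell is one-signed). -/
theorem E_Q : E 14 Q = -1024 := by
  rw [E_eq_dep]
  show linZ [] (dep 14) - linZ QP (dep 14) = -1024
  rw [linZ_nil, linZ_QP_dep]
  rfl

/-- `Q` lies in BRANCH B. -/
theorem branchB_Q : 2 * E 14 Q + |Q.mu.re| ≤ 0 ∧ 2 * E 14 Q + |Q.mu.im| ≤ 0 := by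
  rw [E_Q, mu_Q]
  decide

theorem disj_Q : Disj Q := fun c hN _ => by rw [suppN_Q] at hN; exact absurd hN List.not_mem_nil

theorem d4_suppP : d4 ∈ Q.suppP := mem_suppP_of d4_mem (by decide)

theorem d4_detects : Detects d4 (0 : Fin 4) (1 : Fin 4) := by
  unfold Detects d4; decide

/-- `Q` violates RULE D (P side): nothing supplies the fully charged P-cell `d⁴` — there are no N-cells. -/
theorem not_ruleDP_Q : ¬ RuleDP Q := by
  intro h
  obtain ⟨y, hy, _⟩ := h d4 d4_suppP (0 : Fin 4) (1 : Fin 4) (by decide) d4_detects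
  rw [suppN_Q] at hy
  exact absurd hy List.not_mem_nil

theorem not_ruleD_Q : ¬ RuleD Q := fun h => not_ruleDP_Q h.2

/-- **THE CERTIFICATE FOR `Q`.** -/
theorem cert_Q : Q.OnAlphabet 14 ∧ Q.A1 ∧ Q.mu = ⟨256, 0⟩ ∧ Q.N = [] ∧ E 14 Q = -1024 ∧ Q.rank = -960 ∧ Q.copies = 960 ∧
    (2 * E 14 Q + |Q.mu.re| ≤ 0 ∧ 2 * E 14 Q + |Q.mu.im| ≤ 0) ∧ Disj Q ∧ ¬ RuleDP Q :=
  ⟨onAlphabet_Q, a1_Q, mu_Q, rfl, E_Q, rank_Q, copies_Q, branchB_Q, disj_Q, not_ruleDP_Q⟩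

/-- **ONE-SIGNED (A1)-CLEAN DESIGNS WITH `μ ≠ 0` EXIST** (all cells on the P side). -/
theorem onesigned_exists : ∃ D : Design, D.OnAlphabet 14 ∧ D.A1 ∧ D.mu ≠ 0 ∧ D.N = [] :=
  ⟨Q, onAlphabet_Q, a1_Q, mu_ne_Q, rfl⟩

/-- … and with all cells on the N side. -/
theorem nonly_exists : ∃ D : Design, D.OnAlphabet 14 ∧ D.A1 ∧ D.mu ≠ 0 ∧ D.P = [] :=
  ⟨Qbar, onAlphabet_Qbar, a1_Qbar, mu_ne_Qbar, rfl⟩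

/-- **Q-P ANSWERED: (A1) ∧ μ ≠ 0 does NOT force a hub-free (fully charged) N-cell** (DOOR-PRICE-extremal-g24 §5, strengthen g23 NEXT (3)). -/
theorem not_hubfreeN_forced :
    ¬ (∀ D : Design, D.OnAlphabet 14 → D.A1 → D.mu ≠ 0 → ∃ y ∈ D.suppN, ∀ f : Fin 4, 0 < (y f).colevel) := by
  intro H
  obtain ⟨y, hy, _⟩ := H Q onAlphabet_Q a1_Q mu_ne_Q
  rw [suppN_Q] at hy
  exact absurd hy List.not_mem_nil

/-- **… it does not even force an N-cell.** -/
theorem not_suppN_forced : ¬ (∀ D : Design, D.OnAlphabet 14 → D.A1 → D.mu ≠ 0 → D.suppN ≠ []) :=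
  fun H => H Q onAlphabet_Q a1_Q mu_ne_Q suppN_Q

/-! ## §4 Every height `h ≥ 2` -/

/-- `Q` transported to height `h`. -/
def QAt (h : ℤ) : Design := shiftD (h - 14) Q

theorem onAlphabet_QAt {h : ℤ} (hh : 2 ≤ h) : (QAt h).OnAlphabet h := by
  have e : h = 14 + (h - 14) := by ring
  rw [QAt, e, add_sub_cancel_left]
  exact onAlphabet_shift Q 14 (h - 14) onAlphabet_Q (fun c hc f => by have := level_Q c hc f; omega)

theorem N_QAt (h : ℤ) : (QAt h).N = [] := rfl

/-- **ONE-SIGNED (A1)-CLEAN DESIGNS WITH `μ = 256` AT EVERY HEIGHT `h ≥ 2`.** -/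
theorem cert_QAt {h : ℤ} (hh : 2 ≤ h) :
    (QAt h).OnAlphabet h ∧ (QAt h).A1 ∧ (QAt h).mu = ⟨256, 0⟩ ∧ (QAt h).N = [] ∧ (QAt h).copies = 960 := by
  refine ⟨onAlphabet_QAt hh, a1_shiftD _ _ a1_Q, ?_, rfl, ?_⟩
  · rw [QAt, mu_shiftD, mu_Q]
  · rw [QAt, copies_shift, copies_Q]

theorem not_hubfreeN_forced_at {h : ℤ} (hh : 2 ≤ h) :
    ¬ (∀ D : Design, D.OnAlphabet h → D.A1 → D.mu ≠ 0 → ∃ y ∈ D.suppN, ∀ f : Fin 4, 0 < (y f).colevel) := by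
  intro H
  obtain ⟨hA, h1, hμ, hN, _⟩ := cert_QAt hh
  obtain ⟨y, hy, _⟩ := H (QAt h) hA h1 (by rw [hμ]; decide)
  have : (QAt h).suppN = [] := by unfold Design.suppN; rw [hN]; rfl
  rw [this] at hy
  exact absurd hy List.not_mem_nil

/-! ## §5 P-charged designs: `E`, hub-free P-cells, Branch B -/

/-- HUB-FREE (= fully charged) cell: every letter has positive co-level. -/
def HubFree (c : Cell) : Prop := ∀ f : Fin 4, 0 < (c f).colevel

/-- P-CHARGED design: every supported N-cell has a letter of co-level `0` (on the alphabet: the hub) — no hub-free N-cell. -/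
def PCharged (D : Design) : Prop := ∀ y ∈ D.suppN, ∃ f : Fin 4, (y f).colevel = 0

theorem not_hubFree_iff (c : Cell) : ¬ HubFree c ↔ ∃ f : Fin 4, (c f).colevel = 0 := by
  unfold HubFree
  constructor
  · intro h
    by_contra hc
    push Not at hc
    exact h fun f => lt_of_le_of_ne (colevel_nonneg _) (Ne.symm (hc f))
  · rintro ⟨f, hf⟩ h
    have := h f
    omega

theorem pcharged_iff (D : Design) : PCharged D ↔ ∀ y ∈ D.suppN, ¬ HubFree y := by
  unfold PCharged
  constructor
  · intro h y hy; exact (not_hubFree_iff y).mpr (h y hy)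
  · intro h y hy; exact (not_hubFree_iff y).mp (h y hy)

/-- `Q` is P-charged (vacuously) — and so is every design with `N = []`. -/
theorem pcharged_Q : PCharged Q := fun y hy => by rw [suppN_Q] at hy; exact absurd hy List.not_mem_nil

theorem dep_eq_zero_of_colevel {h : ℤ} {c : Cell} (hc : ∀ f : Fin 4, (c f).OnAlphabet h) {f : Fin 4}
    (h0 : (c f).colevel = 0) : dep h c = 0 := by
  rw [dep_eq_prod_colevel hc]
  exact Finset.prod_eq_zero (Finset.mem_univ f) h0

theorem one_le_dep_of_hubFree {h : ℤ} {c : Cell} (hc : ∀ f : Fin 4, (c f).OnAlphabet h) (hf : HubFree c) : 1 ≤ dep h c := by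
  rw [dep_eq_prod_colevel hc, Fin.prod_univ_four]
  have h0 := hf 0
  have h1 := hf 1
  have h2 := hf 2
  have h3 := hf 3
  have h01 : 1 ≤ (c 0).colevel * (c 1).colevel := by nlinarith
  have h012 : 1 ≤ (c 0).colevel * (c 1).colevel * (c 2).colevel := by nlinarith
  nlinarith

theorem linZ_eq_zero_of (L : List (Cell × ℕ)) (φ : Cell → ℤ) (hφ : ∀ cm ∈ L, 0 < cm.2 → φ cm.1 = 0) : linZ L φ = 0 := by
  induction L with
  | nil => exact linZ_nil φ
  | cons a t ih =>
    rw [linZ_cons, ih fun cm hcm => hφ cm (List.mem_cons_of_mem _ hcm), add_zero]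
    rcases Nat.eq_zero_or_pos a.2 with h0 | hp
    · simp [h0]
    · rw [hφ a List.mem_cons_self hp, mul_zero]

theorem le_linZ_of_mem (L : List (Cell × ℕ)) (φ : Cell → ℤ) (hφ : ∀ cm ∈ L, 0 < cm.2 → 0 ≤ φ cm.1) {cm : Cell × ℕ}
    (hm : cm ∈ L) : (cm.2 : ℤ) * φ cm.1 ≤ linZ L φ := by
  induction L with
  | nil => exact absurd hm List.not_mem_nil
  | cons a t ih =>
    rw [linZ_cons]
    have ht : 0 ≤ linZ t φ := linZ_nonneg t φ fun c hc => hφ c (List.mem_cons_of_mem _ hc)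
    have ha : 0 ≤ (a.2 : ℤ) * φ a.1 := by
      rcases Nat.eq_zero_or_pos a.2 with h0 | hp
      · simp [h0]
      · exact mul_nonneg (by positivity) (hφ a List.mem_cons_self hp)
    rcases List.mem_cons.1 hm with rfl | hmt
    · linarith
    · have := ih (fun c hc => hφ c (List.mem_cons_of_mem _ hc)) hmt
      linarith

theorem linG_eq_zero_of (L : List (Cell × ℕ)) (φ : Cell → GaussianInt) (hφ : ∀ cm ∈ L, 0 < cm.2 → φ cm.1 = 0) :
    linG L φ = 0 := by
  induction L with
  | nil => simp [linG]
  | cons a t ih =>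
    have ht := ih fun cm hcm => hφ cm (List.mem_cons_of_mem _ hcm)
    unfold linG at ht ⊢
    rw [List.map_cons, List.sum_cons, ht, add_zero]
    rcases Nat.eq_zero_or_pos a.2 with h0 | hp
    · simp [h0]
    · rw [hφ a List.mem_cons_self hp, mul_zero]

/-- on a P-charged design the N side carries no `dep`-mass. -/
theorem linZN_dep_eq_zero {h : ℤ} {D : Design} (hD : D.OnAlphabet h) (hP : PCharged D) : linZ D.N (dep h) = 0 := by
  refine linZ_eq_zero_of D.N (dep h) fun cm hm hp => ?_
  obtain ⟨f, hf⟩ := hP cm.1 ((mem_suppN_iff D cm.1).mpr ⟨cm.2, hm, hp⟩)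
  exact dep_eq_zero_of_colevel (onAlphabet_of_N hD hm hp) hf

/-- **`E = −Σ_P m·dep` on a P-charged design.** -/
theorem E_eq_neg_of_pcharged {h : ℤ} {D : Design} (hD : D.OnAlphabet h) (hP : PCharged D) :
    E h D = -linZ D.P (dep h) := by
  rw [E_eq_dep, linZN_dep_eq_zero hD hP, zero_sub]

theorem E_nonpos_of_pcharged {h : ℤ} {D : Design} (hD : D.OnAlphabet h) (hP : PCharged D) : E h D ≤ 0 := by
  rw [E_eq_neg_of_pcharged hD hP]
  have := linZ_nonneg D.P (dep h) fun cm hm hp => dep_nonneg_alphabet (onAlphabet_of_P hD hm hp)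
  linarith

theorem beta_eq_zero_of_colevel {ℓ : Letter} (h0 : ℓ.colevel = 0) : ℓ.beta = 0 := by
  obtain ⟨hx, hy⟩ := (colevel_eq_zero_iff ℓ).mp h0
  unfold Letter.beta
  rw [hx, hy]
  rfl

theorem cellCoef_eeee_eq_zero {c : Cell} {f : Fin 4} (h0 : (c f).colevel = 0) : cellCoef c Word.eeee = 0 := by
  rw [cellCoef_eeee]
  apply Finset.prod_eq_zero (Finset.mem_univ f)
  rw [beta_eq_zero_of_colevel h0, star_zero]

/-- on a P-charged design `μ = −Σ_P m·∏ β̄`. -/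
theorem mu_eq_of_pcharged {h : ℤ} {D : Design} (hD : D.OnAlphabet h) (hP : PCharged D) :
    D.mu = -linG D.P (fun c => cellCoef c Word.eeee) := by
  show D.T Word.eeee = _
  rw [T_eq_linG]
  have hN : linG D.N (fun c => cellCoef c Word.eeee) = 0 := by
    refine linG_eq_zero_of _ _ fun cm hm hp => ?_
    obtain ⟨f, hf⟩ := hP cm.1 ((mem_suppN_iff D cm.1).mpr ⟨cm.2, hm, hp⟩)
    exact cellCoef_eeee_eq_zero hf
  have _ := hD
  rw [hN, zero_sub]

/-- **`μ ≠ 0` on a P-charged design ⇒ a hub-free P-cell.** -/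
theorem hubfreeP_of_mu_ne {h : ℤ} {D : Design} (hD : D.OnAlphabet h) (hP : PCharged D) (hμ : D.mu ≠ 0) :
    ∃ cm ∈ D.P, 0 < cm.2 ∧ HubFree cm.1 := by
  by_contra hcon
  push Not at hcon
  apply hμ
  rw [mu_eq_of_pcharged hD hP, neg_eq_zero]
  refine linG_eq_zero_of _ _ fun cm hm hp => ?_
  obtain ⟨f, hf⟩ := (not_hubFree_iff cm.1).mp (hcon cm hm hp)
  exact cellCoef_eeee_eq_zero hf

/-- **(A1) ∧ μ ≠ 0 ∧ P-charged ⇒ `E ≤ −8`.** -/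
theorem E_le_of_pcharged {h : ℤ} {D : Design} (hD : D.OnAlphabet h) (h1 : D.A1) (hP : PCharged D) (hμ : D.mu ≠ 0) :
    E h D ≤ -8 := by
  obtain ⟨cm, hm, hp, hf⟩ := hubfreeP_of_mu_ne hD hP hμ
  have hdep : 1 ≤ dep h cm.1 := one_le_dep_of_hubFree (onAlphabet_of_P hD hm hp) hf
  have hle := le_linZ_of_mem D.P (dep h) (fun c hc hcp => dep_nonneg_alphabet (onAlphabet_of_P hD hc hcp)) hm
  have hp1 : (1 : ℤ) ≤ (cm.2 : ℤ) := by exact_mod_cast hp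
  have h1le : (1 : ℤ) ≤ linZ D.P (dep h) := by nlinarith
  have hE := E_eq_neg_of_pcharged hD hP
  obtain ⟨q, hq⟩ := (lattice_digits hD (a1e_of_a1 D h1)).1
  omega

/-- the 1-norm `|Re z| + |Im z|` on `ℤ[i]`. -/
def n1 (z : GaussianInt) : ℤ := |z.re| + |z.im|

theorem n1_nonneg (z : GaussianInt) : 0 ≤ n1 z := by unfold n1; positivity

theorem abs_re_le_n1 (z : GaussianInt) : |z.re| ≤ n1 z := by unfold n1; linarith [abs_nonneg z.im]

theorem abs_im_le_n1 (z : GaussianInt) : |z.im| ≤ n1 z := by unfold n1; linarith [abs_nonneg z.re]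

/-- submultiplicativity of the 1-norm. -/
theorem n1_mul_le (z w : GaussianInt) : n1 (z * w) ≤ n1 z * n1 w := by
  unfold n1
  have hre : (z * w).re = z.re * w.re - z.im * w.im := by rw [Zsqrtd.re_mul]; ring
  have him : (z * w).im = z.re * w.im + z.im * w.re := by rw [Zsqrtd.im_mul]
  rw [hre, him]
  have a1 : |z.re * w.re - z.im * w.im| ≤ |z.re| * |w.re| + |z.im| * |w.im| := by
    have := abs_add_le (z.re * w.re) (-(z.im * w.im))
    rw [abs_neg, ← sub_eq_add_neg, abs_mul, abs_mul] at this
    exact this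
  have a2 : |z.re * w.im + z.im * w.re| ≤ |z.re| * |w.im| + |z.im| * |w.re| := by
    have := abs_add_le (z.re * w.im) (z.im * w.re)
    rw [abs_mul, abs_mul] at this
    exact this
  nlinarith [abs_nonneg z.re, abs_nonneg z.im, abs_nonneg w.re, abs_nonneg w.im]

theorem n1_star_beta (ℓ : Letter) : n1 (star ℓ.beta) = ℓ.colevel := by
  unfold n1 Letter.beta Letter.colevel
  simp [abs_neg]

theorem n1_natCast (m : ℕ) : n1 (m : GaussianInt) = m := by
  unfold n1
  simp

/-- `|Re ∏ β̄| + |Im ∏ β̄| ≤ dep` on the alphabet. -/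
theorem n1_cellCoef_eeee_le {h : ℤ} {c : Cell} (hc : ∀ f : Fin 4, (c f).OnAlphabet h) :
    n1 (cellCoef c Word.eeee) ≤ dep h c := by
  rw [cellCoef_eeee, dep_eq_prod_colevel hc, Fin.prod_univ_four, Fin.prod_univ_four]
  have e0 := n1_star_beta (c 0)
  have e1 := n1_star_beta (c 1)
  have e2 := n1_star_beta (c 2)
  have e3 := n1_star_beta (c 3)
  have p0 := n1_nonneg (star (c 0).beta)
  have p1 := n1_nonneg (star (c 1).beta)
  have p2 := n1_nonneg (star (c 2).beta)
  have p3 := n1_nonneg (star (c 3).beta)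
  have m1 := n1_mul_le (star (c 0).beta) (star (c 1).beta)
  have m2 := n1_mul_le (star (c 0).beta * star (c 1).beta) (star (c 2).beta)
  have m3 := n1_mul_le (star (c 0).beta * star (c 1).beta * star (c 2).beta) (star (c 3).beta)
  have q1 := n1_nonneg (star (c 0).beta * star (c 1).beta)
  have q2 := n1_nonneg (star (c 0).beta * star (c 1).beta * star (c 2).beta)
  rw [← e0, ← e1, ← e2, ← e3]
  calc n1 (star (c 0).beta * star (c 1).beta * star (c 2).beta * star (c 3).beta)
      ≤ n1 (star (c 0).beta * star (c 1).beta * star (c 2).beta) * n1 (star (c 3).beta) := m3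
    _ ≤ n1 (star (c 0).beta * star (c 1).beta) * n1 (star (c 2).beta) * n1 (star (c 3).beta) :=
        mul_le_mul_of_nonneg_right m2 p3
    _ ≤ n1 (star (c 0).beta) * n1 (star (c 1).beta) * n1 (star (c 2).beta) * n1 (star (c 3).beta) :=
        mul_le_mul_of_nonneg_right (mul_le_mul_of_nonneg_right m1 p2) p3

theorem n1_add_le (z w : GaussianInt) : n1 (z + w) ≤ n1 z + n1 w := by
  unfold n1
  rw [Zsqrtd.re_add, Zsqrtd.im_add]
  linarith [abs_add_le z.re w.re, abs_add_le z.im w.im]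

/-- `n1 (Σ_L m·∏β̄) ≤ Σ_L m·dep` on the alphabet. -/
theorem n1_linG_le (L : List (Cell × ℕ)) {h : ℤ} (hL : ∀ cm ∈ L, 0 < cm.2 → ∀ f : Fin 4, (cm.1 f).OnAlphabet h) :
    n1 (linG L (fun c => cellCoef c Word.eeee)) ≤ linZ L (dep h) := by
  induction L with
  | nil => simp [linG, linZ, n1]
  | cons a t ih =>
    have ht := ih fun cm hcm => hL cm (List.mem_cons_of_mem _ hcm)
    unfold linG at ht ⊢
    rw [List.map_cons, List.sum_cons, linZ_cons]
    refine le_trans (n1_add_le _ _) (add_le_add ?_ ht)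
    rcases Nat.eq_zero_or_pos a.2 with h0 | hp
    · simp [h0, n1]
    · have haA := hL a List.mem_cons_self hp
      calc n1 ((a.2 : GaussianInt) * cellCoef a.1 Word.eeee)
          ≤ n1 (a.2 : GaussianInt) * n1 (cellCoef a.1 Word.eeee) := n1_mul_le _ _
        _ = (a.2 : ℤ) * n1 (cellCoef a.1 Word.eeee) := by rw [n1_natCast]
        _ ≤ (a.2 : ℤ) * dep h a.1 := mul_le_mul_of_nonneg_left (n1_cellCoef_eeee_le haA) (by positivity)

theorem n1_neg (z : GaussianInt) : n1 (-z) = n1 z := by unfold n1; simp [abs_neg]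

/-- **`|Re μ|, |Im μ| ≤ −E` on a P-charged design.** -/
theorem abs_mu_le_of_pcharged {h : ℤ} {D : Design} (hD : D.OnAlphabet h) (hP : PCharged D) :
    |D.mu.re| ≤ -E h D ∧ |D.mu.im| ≤ -E h D := by
  have hn : n1 D.mu ≤ -E h D := by
    rw [mu_eq_of_pcharged hD hP, n1_neg, E_eq_neg_of_pcharged hD hP, neg_neg]
    exact n1_linG_le D.P fun cm hm hp => onAlphabet_of_P hD hm hp
  exact ⟨le_trans (abs_re_le_n1 _) hn, le_trans (abs_im_le_n1 _) hn⟩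

/-- **P-CHARGED (A1) DESIGNS ARE IN BRANCH B** (with `μ ≠ 0` or not). -/
theorem branchB_of_pcharged {h : ℤ} {D : Design} (hD : D.OnAlphabet h) (hP : PCharged D) :
    2 * E h D + |D.mu.re| ≤ 0 ∧ 2 * E h D + |D.mu.im| ≤ 0 := by
  obtain ⟨hre, him⟩ := abs_mu_le_of_pcharged hD hP
  have hE := E_nonpos_of_pcharged hD hP
  constructor <;> linarith

/-- **P pair-carriers at every slot pair** of a P-charged (A1) design with `μ ≠ 0`. -/
theorem pcharged_pCarrier {h : ℤ} {D : Design} (hD : D.OnAlphabet h) (h1 : D.A1) (hP : PCharged D) (hμ : D.mu ≠ 0)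
    {g g' : Fin 4} (hne : g ≠ g') :
    ∃ cm ∈ D.P, 0 < cm.2 ∧ ((cm.1 g).x ≠ 0 ∧ (cm.1 g).y ≠ 0) ∧ ((cm.1 g').x ≠ 0 ∧ (cm.1 g').y ≠ 0) :=
  pCarrier_of_E_le hD h1 (E_le_of_pcharged hD h1 hP hμ) hne

/-! ## §6 The COMPASS LEMMA (RULE D, P side) and the corner package -/

/-- **COMPASS LEMMA**: on a P-charged design satisfying RULE D (P side), every hub-free P-cell has an AXIS letter on every block. -/
theorem compass {h : ℤ} {D : Design} (hD : D.OnAlphabet h) (hr : RuleDP D) (hP : PCharged D)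
    {x : Cell} (hx : x ∈ D.suppP) (hfc : HubFree x) {g j : Fin 4} (hgj : g < j) :
    (x g).isAxis ∨ (x j).isAxis := by
  have hxA : ∀ f : Fin 4, (x f).OnAlphabet h := hD x (mem_supp_of_memP D hx)
  have hdet : Detects x g j := by
    intro hc
    exact (colevel_pos_iff (x g)).mp (hfc g) ⟨hc.1, hc.2.1⟩
  obtain ⟨y, hy, hoff, hg, hj⟩ := hr x hx g j hgj hdet
  have hyA : ∀ f : Fin 4, (y f).OnAlphabet h := hD y (mem_supp_of_memN D hy)
  obtain ⟨f, hf0⟩ := hP y hy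
  have hyf : y f = Letter.hub h := eq_hub_of_colevel_eq_zero (hyA f) hf0
  have pull : ∀ {s : Fin 4}, (x s = y s ∨ NullStep (x s) (y s)) → y s = Letter.hub h → (x s).isAxis := by
    intro s hs hys
    rcases hs with he | hn
    · exfalso
      have := hfc s
      rw [he, hys, colevel_hub] at this
      exact lt_irrefl _ this
    · rw [hys] at hn
      exact ((nullStep_hub_iff (hxA s)).mp hn).2
  by_cases hfg : f = g
  · subst hfg; exact Or.inl (pull hg hyf)
  by_cases hfj : f = j
  · subst hfj; exact Or.inr (pull hj hyf)
  · exfalso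
    have he : x f = y f := hoff f hfg hfj
    have := hfc f
    rw [he, hyf, colevel_hub] at this
    exact lt_irrefl _ this

theorem not_isAxis_of_offAxis {ℓ : Letter} (h : OffAxis ℓ) : ¬ ℓ.isAxis := by
  unfold Letter.isAxis
  exact mul_ne_zero h.1 h.2

/-- **AT MOST ONE OFF-AXIS LETTER** on a hub-free P-cell of a P-charged RULE-D design. -/
theorem atMostOneOffAxis {h : ℤ} {D : Design} (hD : D.OnAlphabet h) (hr : RuleDP D) (hP : PCharged D)
    {x : Cell} (hx : x ∈ D.suppP) (hfc : HubFree x) {g j : Fin 4} (hne : g ≠ j) :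
    ¬ (OffAxis (x g) ∧ OffAxis (x j)) := by
  rintro ⟨hg, hj⟩
  rcases lt_or_gt_of_ne hne with hlt | hlt
  · rcases compass hD hr hP hx hfc hlt with ha | ha
    · exact not_isAxis_of_offAxis hg ha
    · exact not_isAxis_of_offAxis hj ha
  · rcases compass hD hr hP hx hfc hlt with ha | ha
    · exact not_isAxis_of_offAxis hj ha
    · exact not_isAxis_of_offAxis hg ha

/-- **A hub-free P-cell with two off-axis letters forces a hub-free N-cell** (RULE D, P side). -/
theorem hubfreeN_of_twoOffAxis {h : ℤ} {D : Design} (hD : D.OnAlphabet h) (hr : RuleDP D)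
    {x : Cell} (hx : x ∈ D.suppP) (hfc : HubFree x) {g j : Fin 4} (hne : g ≠ j) (hg : OffAxis (x g)) (hj : OffAxis (x j)) :
    ∃ y ∈ D.suppN, HubFree y := by
  by_contra hcon
  push Not at hcon
  exact atMostOneOffAxis hD hr ((pcharged_iff D).mpr hcon) hx hfc hne ⟨hg, hj⟩

/-- **SIX HH-CORNERED FAT P-CELLS** on a P-charged door-type design (RULE D both sides, `Disj`): for every slot pair `(g,j)` and its
complement `(g′,j′)` a supported P-cell off-axis on `g, j` and HUB on `g′, j′` — a hub-BEARING cell, disjoint from the compass cells. -/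
theorem pcharged_corner {h : ℤ} {D : Design} (hD : D.OnAlphabet h) (h1 : D.A1) (hμ : D.mu ≠ 0) (hP : PCharged D)
    (hr : RuleD D) (hdis : Disj D) (g j g' j' : Fin 4) (hgj : g < j) (hg'j' : g' < j')
    (e1 : g ≠ g') (e2 : g ≠ j') (e3 : j ≠ g') (e4 : j ≠ j') :
    ∃ x ∈ D.suppP, HubPair h x g' j' ∧ OffAxis (x g) ∧ OffAxis (x j) := by
  obtain ⟨cm, hm, hp, hoffg, hoffj⟩ := pcharged_pCarrier hD h1 hP hμ (ne_of_lt hgj)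
  have hx : cm.1 ∈ D.suppP := (mem_suppP_iff D cm.1).mpr ⟨cm.2, hm, hp⟩
  exact hhCorner_of_pCarrier h D hD hr hdis g j g' j' hgj hg'j' e1 e2 e3 e4 hx hoffg hoffj

/-- the corner cells are NOT hub-free (they carry two hubs), while the cells carrying `μ` ARE (`hubfreeP_of_mu_ne`): the P side of a
P-charged door-type design has at least two kinds of cells. -/
theorem not_hubFree_of_hubPair {h : ℤ} {D : Design} (hD : D.OnAlphabet h) {x : Cell} (hx : x ∈ D.suppP) {g' j' : Fin 4}
    (hh : HubPair h x g' j') : ¬ HubFree x := by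
  intro hf
  have hxA : ∀ f : Fin 4, (x f).OnAlphabet h := hD x (mem_supp_of_memP D hx)
  have := hf g'
  rw [colevel_eq_of_onAlphabet (hxA g')] at this
  exact hh.1 (by omega)

end Summit.HodgeConjecture.HodgeConjecture.Cruxes.BlochSeedDiscOne.OneSignedShell
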